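import Summits.BirchSwinnertonDyer.BirchSwinnertonDyer.Theses.SchneiderFreeAdditiveX3
import Summits.BirchSwinnertonDyer.BirchSwinnertonDyer.Theorems.SchneiderFreeControlAtoms
import HarnessLib

/-!
# Crux `AnticycControlAdditive` (route `SchneiderFreeAdditiveX3`, item stmt-BirchSwinnertonDyer-19178):
# the `t_p = 0` stub CLOSED MODULO the four Poitou–Tate / local atoms, at CLASS LEVEL

Seat `bsd-schneider-door-c4` (cell `bsd-schneider-ideate`). The registered stub
`stub_control_noLocalPTorsion` of the BC3 skeleton (sha `4a862010…`) asks, at every B6 Heegner datum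
and every anticyclotomic frame `(κ, γ, 𝔭)` WITH `E(K_𝔭)[p] = 0` (hypothesis `h0`), for the pointwise
control EQUALITY `SchneiderFree.AdditiveControlOnTreeAt`. This file proves that stub from the four
atoms of JSW17 §3 typed on the tree's constructed objects — (P6-add) `AdditiveBaseSelmerCountAt`
(JSW17 Prop. 3.2.1 read at an additive `p`, local index `[E(ℚ_p):E₁(ℚ_p)] = p·c_p`), (P9) `X11b.LocSurjAt`
on `Σ(N⁺)` (JSW17 Prop. 3.3.2), (L10) `X11b.CoinvariantsTrivialAt` (JSW17 Lemma 3.3.3) and (P11)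
`X11b.R1LocalKernelOrderAt` (JSW17 Prop. 3.3.4 Case 1(a)) — carried as HYPOTHESES quantified over the
same data (restricted to `h0`-data for the Poitou–Tate triple: (P6-add) as typed is the `t_p = 0`
count; see the seat's derivation memo for the `t_p ≥ 1` count, where the base count acquires
`+ g − t_p`, `g = ord_p #E(K)[p^∞]`). Everything else is the kernel theorem
`SchneiderFreeControlAtoms.additiveControlOnTreeAt_of_atoms` (the BC5 rung) plus frame plumbing:
`p ∣ N_E` from additive reduction, `p` split in `K` from the Heegner hypothesis.
CONDITIONAL on the atoms; closes nothing by itself; BSD is not proved by any of this.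

References: [JetchevSkinnerWan2017] §3.2–3.3 (arXiv:1512.06894 pp. 10–14); [Castella2018] Thm. 2.3.
-/

noncomputable section

open scoped Classical

open WeierstrassCurve NumberField IsDedekindDomain Field Literature.NumberTheory.EllipticCurves
  Literature.NumberTheory.EllipticCurves.ModularForms
  Literature.NumberTheory.EllipticCurves.GreenbergSelmer
  Literature.NumberTheory.EllipticCurves.Rank1Residual
  Literature.NumberTheory.EllipticCurves.Rank1Residual.Typed
  Summit.BirchSwinnertonDyer.Rank1Residual
  Summit.BirchSwinnertonDyer.Rank1Residual.X11b
  Summit.BirchSwinnertonDyer.Rank1Residual.X11b.AcSelmer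
  Summit.BirchSwinnertonDyer.Rank1Residual.X11b.Halves
  Summit.BirchSwinnertonDyer.BirchSwinnertonDyer.Theorems.SchneiderFree
  Summit.BirchSwinnertonDyer.BirchSwinnertonDyer.Theorems.SchneiderFreeControlAtoms
  Summit.BirchSwinnertonDyer.BirchSwinnertonDyer.Theses.SchneiderFreeAdditiveX3

set_option linter.dupNamespace false

namespace Summit.BirchSwinnertonDyer.BirchSwinnertonDyer.Theorems.SchneiderFreeAdditiveX3

/-- Frame plumbing: at an additive prime, `p ∣ N_E`. [folklore] -/
theorem dvd_conductorNorm_of_n10Locus {W : WeierstrassCurve ℚ} [W.IsElliptic] {p : ℕ} [Fact p.Prime]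
    (h : Additive.N10.Locus W p) : p ∣ W.conductorNorm ℤ :=
  (W.dvd_conductorNorm_iff_not_hasGoodReductionAtPrime p).mpr h.2.1.1

/-- Frame plumbing: the Heegner hypothesis for `N_E` and `p ∣ N_E` give `p` split in `K`. [folklore] -/
theorem splitsIn_of_satisfiesHeegnerHypothesis {K : Type} [Field K] [NumberField K]
    {W : WeierstrassCurve ℚ} {N p : ℕ} [Fact p.Prime] (hN : W.conductorNorm ℤ = N)
    (hH : SatisfiesHeegnerHypothesis N K) (hpN : p ∣ W.conductorNorm ℤ) : SplitsIn K p :=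
  hH p Fact.out (hN ▸ hpN)

/-- **The `t_p = 0` stub of crux `AnticycControlAdditive` from the atoms (class level).** IF, at
every B6 Heegner datum and every anticyclotomic frame with `E(K_𝔭)[p] = 0`, the three Poitou–Tate
atoms hold — (P6-add) `AdditiveBaseSelmerCountAt p 𝔭 (embAt K p 𝔭) P`, (P9) `LocSurjAt` on `Σ(N⁺)`,
(L10) `CoinvariantsTrivialAt` — and IF the local Tamagawa atom (P11) holds at every `w ∈ Σ(N⁺)`
(`X11b.R1LocalKernelOrderAt W p`), THEN the registered stub `stub_control_noLocalPTorsion` holds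
verbatim: `AdditiveControlOnTreeAt p κ 𝔭 γ (embAt K p 𝔭) P` at every such datum. The control-map
bijection, the `Σ(N⁺) → ∅` passage, the Euler-characteristic form and the Tamagawa bookkeeping are
kernel theorems (`additiveControlOnTreeAt_of_atoms`); no irreducibility, no semistability, no (HT).
[cite: JetchevSkinnerWan2017, Thm. 3.3.1 and §3.2–3.3 (arXiv:1512.06894 pp. 10–14)]
[cite: Castella2018, Thm. 2.3 (arXiv:1704.06608 p. 5)] -/
theorem stub_control_noLocalPTorsion_of_atoms
    (hPT : ∀ (W : WeierstrassCurve ℚ) [W.IsElliptic] [W.IsGloballyMinimal] (p : ℕ) [Fact p.Prime],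
      W.analyticRank = 1 → p ≠ 2 → ClassX3 W p → Additive.SubSemistableTwist W p →
      ∀ (N : ℕ) [NeZero N] (K : Type) [Field K] [NumberField K]
        (Dt : ModularParametrizationData W N) (H : HeegnerDatum N (NumberField.discr K)) (ι : K →+* ℂ)
        (P : (W.baseChange K).toAffine.Point),
        W.analyticRank = 1 → Additive.N10.Locus W p → W.conductorNorm ℤ = N →
        ∀ hK : IsImaginaryQuadratic K,
        Odd (NumberField.discr K) → ¬ p ∣ Units.torsionOrder K → SatisfiesHeegnerHypothesis N K →
        (W.quadraticTwist (NumberField.discr K : ℚ)).entireLFunction 1 ≠ 0 →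
        WeierstrassCurve.Affine.Point.map ι.toRatAlgHom P = heegnerPointComplex Dt H →
        ¬ IsOfFinAddOrder P →
        ∀ (κ : ZpExtension K p), κ.IsAnticyclotomic →
          ∀ (γ : Field.absoluteGaloisGroup K) [Fact (κ.IsTopGenerator γ)]
            (𝔭 : HeightOneSpectrum (𝓞 K)) (h𝔭 : ((p : ℕ) : 𝓞 K) ∈ 𝔭.asIdeal)
            (he : 𝔭.asIdeal.ramificationIdx (𝓞 ℚ) = 1) (hf : 𝔭.asIdeal.inertiaDeg (𝓞 ℚ) = 1),
            (∀ m : (W.baseChange K).geomPrimaryTorsion p,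
              (∀ d ∈ decomp 𝔭, d • m = m) → p • m = 0 → m = 0) →
            AdditiveBaseSelmerCountAt p 𝔭 (embAt K p 𝔭 h𝔭 he hf) P ∧
              X11b.LocSurjAt (W.baseChange K) p 𝔭 (X11b.nPlusPlaces_finite (W := W) (p := p) hK.1) ∧
                X11b.CoinvariantsTrivialAt (W.baseChange K) p κ 𝔭 γ)
    (hL : ∀ (W : WeierstrassCurve ℚ) [W.IsElliptic] [W.IsGloballyMinimal] (p : ℕ) [Fact p.Prime],
      Additive.N10.Locus W p → X11b.R1LocalKernelOrderAt W p) :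
    ∀ (W : WeierstrassCurve ℚ) [W.IsElliptic] [W.IsGloballyMinimal] (p : ℕ) [Fact p.Prime],
      W.analyticRank = 1 → p ≠ 2 → ClassX3 W p → Additive.SubSemistableTwist W p →
      ∀ (N : ℕ) [NeZero N] (K : Type) [Field K] [NumberField K]
        (Dt : ModularParametrizationData W N) (H : HeegnerDatum N (NumberField.discr K)) (ι : K →+* ℂ)
        (P : (W.baseChange K).toAffine.Point),
        W.analyticRank = 1 → Additive.N10.Locus W p → W.conductorNorm ℤ = N → IsImaginaryQuadratic K →
        Odd (NumberField.discr K) → ¬ p ∣ Units.torsionOrder K → SatisfiesHeegnerHypothesis N K →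
        (W.quadraticTwist (NumberField.discr K : ℚ)).entireLFunction 1 ≠ 0 →
        WeierstrassCurve.Affine.Point.map ι.toRatAlgHom P = heegnerPointComplex Dt H →
        ¬ IsOfFinAddOrder P →
        ∀ (κ : ZpExtension K p), κ.IsAnticyclotomic →
          ∀ (γ : Field.absoluteGaloisGroup K) [Fact (κ.IsTopGenerator γ)]
            (𝔭 : HeightOneSpectrum (𝓞 K)) (h𝔭 : ((p : ℕ) : 𝓞 K) ∈ 𝔭.asIdeal)
            (he : 𝔭.asIdeal.ramificationIdx (𝓞 ℚ) = 1) (hf : 𝔭.asIdeal.inertiaDeg (𝓞 ℚ) = 1),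
            (∀ m : (W.baseChange K).geomPrimaryTorsion p,
              (∀ d ∈ decomp 𝔭, d • m = m) → p • m = 0 → m = 0) →
            AdditiveControlOnTreeAt p κ 𝔭 γ (embAt K p 𝔭 h𝔭 he hf) P := by
  intro W _ _ p _ hr hp2 hX hS N _ K _ _ Dt H ι P hr' hloc hN hK hodd hunit hHe hL1 hP hnt κ hκ γ _ 𝔭
    h𝔭 he hf h0
  have hpN : p ∣ W.conductorNorm ℤ := dvd_conductorNorm_of_n10Locus hloc
  have hsplit : SplitsIn K p := splitsIn_of_satisfiesHeegnerHypothesis hN hHe hpN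
  obtain ⟨h6, h9, h10⟩ :=
    hPT W p hr hp2 hX hS N K Dt H ι P hr' hloc hN hK hodd hunit hHe hL1 hP hnt κ hκ γ 𝔭 h𝔭 he hf h0
  exact additiveControlOnTreeAt_of_atoms (W := W) hK hsplit hpN hκ γ 𝔭 (embAt K p 𝔭 h𝔭 he hf) P h0
    h6 h9 h10 (hL W p hloc K hK κ hκ)

end Summit.BirchSwinnertonDyer.BirchSwinnertonDyer.Theorems.SchneiderFreeAdditiveX3

end
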